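import Summits.ABC.ABC.Theorems.AbcStewartYu1991Uniform
import HarnessLib

/-!
# The uniform Stewart–Yu 1991 exponent with an EXPLICIT constant (papers lane ABC-P1, writer seat; theorems only)

`Summits/ABC/ABC/Theorems/AbcStewartYu1991UniformExplicit.lean`.  `stewartYu1991_uniform_exponent` (p489254) states
`∃ C > 0, ∀ abc triples with c ≥ 3: log c < G^{2/3 + C/log log G}`; its proof's witness is explicit.  This file states the SAME bound
with the witness WRITTEN INTO THE STATEMENT (so that the constant of the uniform Math. Ann. 291 theorem's shape is a closed term of a
kernel statement — «effectively computable» in the plainest sense, though absurd in size):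

* `stewartYu1991_uniform_exponent_explicit` — for every abc triple with `c ≥ 3`,
  `log c < G^{2/3 + C₀/log log G}` with `C₀ = 201 + log D · (40/3 + 400·D^{8/3}/log 4)`, `D = (24600·2^73)^2` (`C₀ ≈ 10^{145}`;
  natural logarithms), by the proof of `stewartYu1991_uniform_exponent` with `log κ(1) ≤ 100·D^{8/3}` (`log_twoThirdsKappa_le` at `δ = 3/8`).

No new definition; [folklore] bookkeeping.  WHAT THIS IS NOT: no usable constant; no progress on abc. [cite: StewartYu1991, Theorem (p. 226)]
-/

set_option linter.dupNamespace false

noncomputable section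

open Finset Real
open Literature.NumberTheory.DiophantineGeometry
open Literature.NumberTheory.DiophantineGeometry.Pasten
open Literature.Barriers.ABC

namespace Summit.ABC.ABC.Theorems

set_option maxHeartbeats 400000 in
/-- **Stewart–Yu 1991, the uniform exponent with an EXPLICIT constant**: for every abc triple `a + b = c` with `c ≥ 3`,
`log c < G^{2/3 + C₀/log log G}`, `G = rad(abc)`, `C₀ = 201 + log D·(40/3 + 400·D^{8/3}/log 4)`, `D = (24600·2^73)^2` (`≈ 10^{145}`) —
the witness of `stewartYu1991_uniform_exponent` written into the statement. [cite: StewartYu1991, Theorem (p. 226)] -/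
theorem stewartYu1991_uniform_exponent_explicit (a b c : ℕ) (ht : IsABCTriple a b c) (hc3 : 3 ≤ c) :
    Real.log c < (rad a b c : ℝ) ^ (2 / 3 +
      (201 + Real.log ((24600 * 2 ^ 73 : ℝ) ^ 2) *
          (40 / 3 + 400 * ((24600 * 2 ^ 73 : ℝ) ^ 2) ^ (8 / 3 : ℝ) / Real.log 4)) /
        Real.log (Real.log (rad a b c : ℝ))) := by
  classical
  -- the constant `D` of the explicit theorem and its size
  set D : ℝ := (24600 * 2 ^ 73 : ℝ) ^ 2 with hD
  have hD169 : (169 : ℝ) ≤ D := by rw [hD]; norm_num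
  have hD0 : 0 < D := by linarith
  have hlD1 : 1 ≤ Real.log D := by
    rw [← Real.log_exp 1]
    apply Real.log_le_log (Real.exp_pos 1)
    have := Real.exp_one_lt_d9; linarith
  have hlD2 : Real.log D ≤ 122 := by
    have h1 : D ≤ 2 ^ 176 := by rw [hD]; norm_num
    have h2 : Real.log D ≤ Real.log ((2 : ℝ) ^ 176) := Real.log_le_log hD0 h1
    have h3 : Real.log ((2 : ℝ) ^ 176) = 176 * Real.log 2 := by
      rw [Real.log_pow]; norm_num
    have := Real.log_two_lt_d9
    linarith
  set LD : ℝ := Real.log D with hLD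
  have hLD0 : 0 < LD := by linarith
  -- the explicit bound at `ε = 1`, its closed constant `κ₁`, and `log κ₁ ≤ 100·D^{8/3}`
  have hB := abc_log_le_explicit_mul_rad_pow_twoThirds_add one_pos a b c ht hc3
  set δ₁ : ℝ := min (1 / 2) (3 * 1 / 8) with hδ₁
  have hδ₁v : δ₁ = 3 / 8 := by
    rw [hδ₁, min_eq_right (show (3 * 1 / 8 : ℝ) ≤ 1 / 2 by norm_num)]; norm_num
  have hδ₁0 : 0 < δ₁ := by rw [hδ₁v]; norm_num
  have hδ₁2 : δ₁ ≤ 1 / 2 := by rw [hδ₁v]; norm_num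
  set κ₁ : ℝ := (6 * (23040000 * D ^ ⌈D ^ (1 / δ₁)⌉₊ * (12 / δ₁) ^ 12) ^ (1 / 3 : ℝ) / δ₁) ^ (1 / (1 - δ₁)) with hκ₁def
  have hκ₁0 : 0 < κ₁ := by rw [hκ₁def]; positivity
  set M₁ : ℝ := D ^ (8 / 3 : ℝ) with hM₁
  have hM₁0 : 0 < M₁ := Real.rpow_pos_of_pos hD0 _
  have hlogκ₁M : Real.log κ₁ ≤ 100 * M₁ := by
    have h : Real.log κ₁ ≤ 100 * D ^ (1 / δ₁) := log_twoThirdsKappa_le hD169 hlD1 hlD2 hδ₁0 hδ₁2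
    have e : D ^ (1 / δ₁) = M₁ := by rw [hM₁, hδ₁v]; norm_num
    rw [e] at h
    exact h
  set κ₁' : ℝ := max κ₁ 1 with hκ₁'
  have hκ₁'1 : 1 ≤ κ₁' := le_max_right _ _
  have hlκ₁' : 0 ≤ Real.log κ₁' := Real.log_nonneg hκ₁'1
  have hlκ₁ : Real.log κ₁ ≤ Real.log κ₁' := Real.log_le_log hκ₁0 (le_max_left _ _)
  have hl4 : 1 < Real.log 4 := by
    rw [Real.lt_log_iff_exp_lt (by norm_num)]
    have := Real.exp_one_lt_d9; linarith
  have hl40 : 0 < Real.log 4 := by linarith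
  set r₁ : ℝ := Real.log κ₁' / Real.log 4 with hr₁
  have hr₁0 : 0 ≤ r₁ := div_nonneg hlκ₁' hl40.le
  have hr₁M : r₁ ≤ 100 * M₁ / Real.log 4 := by
    rw [hr₁]
    apply div_le_div_of_nonneg_right _ hl40.le
    rcases le_total κ₁ 1 with h1 | h1
    · have : κ₁' = 1 := by rw [hκ₁']; exact max_eq_right h1
      rw [this, Real.log_one]; positivity
    · have : κ₁' = κ₁ := by rw [hκ₁']; exact max_eq_left h1
      rw [this]; exact hlogκ₁M
  -- the constant (explicit)
  set C : ℝ := 201 + LD * (40 / 3 + 400 * M₁ / Real.log 4) with hC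
  have hCge2 : 201 + 16 / 3 * LD + 4 * LD * (2 + r₁) ≤ C := by
    have h1 : 4 * LD * r₁ ≤ 4 * LD * (100 * M₁ / Real.log 4) := mul_le_mul_of_nonneg_left hr₁M (by positivity)
    calc 201 + 16 / 3 * LD + 4 * LD * (2 + r₁) = 201 + 40 / 3 * LD + 4 * LD * r₁ := by ring
      _ ≤ 201 + 40 / 3 * LD + 4 * LD * (100 * M₁ / Real.log 4) := by linarith only [h1]
      _ = C := by rw [hC]; ring
  have hCge1 : 201 + 16 / 3 * LD ≤ C := by
    have : 0 ≤ 4 * LD * (2 + r₁) := by positivity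
    linarith only [hCge2, this]
  have hC0 : 0 < C := by linarith only [hCge1, hLD0]
  -- drop the defining equations of the big closed terms (not needed below; keeps `linarith` fast)
  clear hκ₁def hδ₁ hδ₁v hδ₁0 hδ₁2 hM₁ hlogκ₁M hr₁M hκ₁'
  set G : ℝ := (rad a b c : ℝ) with hGdef
  have hG4 : 4 ≤ G := four_le_rad_real ht hc3
  have hG0 : 0 < G := by linarith
  set LG : ℝ := Real.log G with hLGdef
  have hLG4 : Real.log 4 ≤ LG := Real.log_le_log (by norm_num) hG4
  have hLG1 : 1 < LG := lt_of_lt_of_le hl4 hLG4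
  have hLG0 : 0 < LG := by linarith
  set LL : ℝ := Real.log LG with hLLdef
  have hLL0 : 0 < LL := Real.log_pos hLG1
  have hGpow : ∀ x : ℝ, G ^ x = Real.exp (x * LG) := fun x => by
    rw [Real.rpow_def_of_pos hG0, mul_comm]
  rw [hGpow]
  by_cases hcase : 4 * LD ≤ LL
  · -- many primes: `ε = (16/3) log D / log log G ≤ 4/3`
    set ε : ℝ := 16 / 3 * LD / LL with hε
    have hε0 : 0 < ε := by positivity
    have hεLL : ε * LL = 16 / 3 * LD := by rw [hε]; field_simp
    have hε43 : ε ≤ 4 / 3 := by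
      rw [hε, div_le_iff₀ hLL0]; linarith
    have hδ : min (1 / 2 : ℝ) (3 * ε / 8) = 3 * ε / 8 := min_eq_right (by linarith)
    have hA := abc_log_le_explicit_mul_rad_pow_twoThirds_add hε0 a b c ht hc3
    rw [hδ] at hA
    set κ : ℝ := (6 * (23040000 * D ^ ⌈D ^ (1 / (3 * ε / 8))⌉₊ * (12 / (3 * ε / 8)) ^ 12) ^ (1 / 3 : ℝ) /
      (3 * ε / 8)) ^ (1 / (1 - 3 * ε / 8)) with hκdef
    have hκ0 : 0 < κ := by rw [hκdef]; positivity
    have hlogκ : Real.log κ ≤ 100 * D ^ (1 / (3 * ε / 8)) :=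
      log_twoThirdsKappa_le hD169 hlD1 hlD2 (by positivity) (by linarith)
    -- `D^{1/δ} = exp(LL/2) = √(log G)`
    have hM : D ^ (1 / (3 * ε / 8)) = Real.exp (LL / 2) := by
      rw [Real.rpow_def_of_pos hD0, ← hLD]
      congr 1
      have hLL0' : LL ≠ 0 := hLL0.ne'
      rw [hε]
      field_simp
      ring
    have hS0 : 0 < Real.exp (LL / 2) := Real.exp_pos _
    have hS2 : Real.exp (LL / 2) * Real.exp (LL / 2) = LG := by
      rw [← Real.exp_add, show LL / 2 + LL / 2 = LL by ring, hLLdef, Real.exp_log hLG0]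
    have hLLS : LL ≤ 2 * Real.exp (LL / 2) := by
      have := Real.add_one_le_exp (LL / 2); linarith
    have key : Real.log κ + (2 / 3 + ε) * LG < (2 / 3 + C / LL) * LG := by
      have h1 : ε * LG = 16 / 3 * LD * LG / LL := by rw [hε]; ring
      have hCge : 201 + 16 / 3 * LD ≤ C := hCge1
      have h2 : (201 + 16 / 3 * LD) * LG / LL ≤ C * LG / LL :=
        div_le_div_of_nonneg_right (mul_le_mul_of_nonneg_right hCge hLG0.le) hLL0.le
      have h2' : C * LG / LL = C / LL * LG := by ring
      have h3 : 100 * Real.exp (LL / 2) < 201 * LG / LL := by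
        rw [lt_div_iff₀ hLL0]
        have h3a : Real.exp (LL / 2) * LL ≤ Real.exp (LL / 2) * (2 * Real.exp (LL / 2)) :=
          mul_le_mul_of_nonneg_left hLLS hS0.le
        have h3b : Real.exp (LL / 2) * (2 * Real.exp (LL / 2)) = 2 * LG := by rw [← hS2]; ring
        nlinarith [h3a, h3b, hLG0]
      calc Real.log κ + (2 / 3 + ε) * LG ≤ 100 * Real.exp (LL / 2) + (2 / 3 + ε) * LG := by
            rw [← hM]; linarith
        _ < 201 * LG / LL + (2 / 3 + ε) * LG := by linarith
        _ = 2 / 3 * LG + (201 + 16 / 3 * LD) * LG / LL := by rw [add_mul, h1]; ring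
        _ ≤ 2 / 3 * LG + C / LL * LG := by rw [← h2']; linarith
        _ = (2 / 3 + C / LL) * LG := by ring
    calc Real.log c ≤ κ * G ^ (2 / 3 + ε) := hA
      _ = Real.exp (Real.log κ + (2 / 3 + ε) * LG) := by
          rw [Real.exp_add, Real.exp_log hκ0, hGpow]
      _ < Real.exp ((2 / 3 + C / LL) * LG) := Real.exp_lt_exp.mpr key
  · -- few primes: `ε = 1`, the constant is absorbed by `G^{C/log log G − 1}`
    push Not at hcase
    have key : Real.log κ₁ + (2 / 3 + 1) * LG < (2 / 3 + C / LL) * LG := by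
      -- `C/LL > C/(4 LD) ≥ 2 + r₁`
      have h1 : C / (4 * LD) < C / LL := div_lt_div_of_pos_left hC0 hLL0 hcase
      have h2 : 2 + r₁ ≤ C / (4 * LD) := by
        rw [le_div_iff₀ (by positivity)]
        have : (0 : ℝ) ≤ 201 + 16 / 3 * LD := by positivity
        nlinarith [hCge2]
      have h3 : (2 + r₁) * LG < C / LL * LG := by
        apply mul_lt_mul_of_pos_right _ hLG0; linarith
      -- `r₁ · LG ≥ log κ₁' ≥ log κ₁`
      have h4 : Real.log κ₁' ≤ r₁ * LG := by
        calc Real.log κ₁' = r₁ * Real.log 4 := by rw [hr₁]; field_simp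
          _ ≤ r₁ * LG := mul_le_mul_of_nonneg_left hLG4 hr₁0
      linarith [h1, h2, h3, h4, hlκ₁, hLG0]
    calc Real.log c ≤ κ₁ * G ^ (2 / 3 + 1 : ℝ) := hB
      _ = Real.exp (Real.log κ₁ + (2 / 3 + 1) * LG) := by
          rw [Real.exp_add, Real.exp_log hκ₁0, hGpow]
      _ < Real.exp ((2 / 3 + C / LL) * LG) := Real.exp_lt_exp.mpr key


end Summit.ABC.ABC.Theorems

end
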